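import Summits.Ventures.WeilGRH.ThirdPrimeReflectionTransfer
import Summits.Ventures.WeilGRH.DualTrigKernelDigamma
import Literature.NumberTheory.LFunctions.WeilFinitePrimeQuadraticChar
import HarnessLib

/-!
# GRH arm (rh-explicit, venture WeilGRH): a UNIFORM conductor floor for every rung, without `ζ` input

Cell `rh-explicit`, WEIL TRACK — GRH ARM (weil-grh-1).  For a Dirichlet character `χ` mod `q ≠ 1`
(any parity `κ = a_χ`, any values, imprimitive allowed) and a test function `g` supported in `[-t, t]`,
with `k = g ⋆ g̃`, `x = 1/4 + κ/2` and `N + 1 ≥ e^{2t}`, Weil's twisted form is (no polar term)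

  `Re Q_χ(g) = (log q − log π)‖g‖₂² + (1/2π)∫|ĝ(1/2+iτ)|² Re ψ(x + iτ/2) dτ
               − Re Σ_{n ≤ N} (Λ(n)/√n)[χ(n) k(log n) + χ̄(n) k(−log n)]`

(`weilFunctionalChar`, `weilArchIntegralChar_weilConv_weilReflect`, `weilPrimeTermChar_eq_sum_of_tsupport_subset`).
Two elementary bounds make it non-negative for EVERY character once `log q` clears an explicit budget:

* ARCHIMEDEAN (`UniformFloor.arch_lower_bound`): by the vertical series
  `Re ψ(x + iy) = ψ(x) + Σ_{m ≥ 0} y²/(l_m(l_m² + y²))`, `l_m = m + x` (`DigammaVertical.hasSum_vterm`), and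
  `y²/(l(l² + y²)) = 1/l − l/(l² + y²)`, keeping `M` terms gives
  `Re ψ(x + iτ/2) ≥ ψ(x) + Σ_{m<M} 1/l_m − Σ_{m<M} l_m/(l_m² + τ²/4)`; each Lorentzian has `∫ dτ = 2π` and is paid
  with `|ĝ(1/2+iτ)|² ≤ 2t‖g‖₂²` (Cauchy–Schwarz on the support), so
  `(1/2π)∫|ĝ|² Re ψ(x + iτ/2) ≥ [ψ(x) + Σ_{m<M}(1/l_m − 2t)]·‖g‖₂²`;
* PRIMES (`UniformFloor.norm_weilPrimeTermChar_le`): `|k(L)| ≤ ‖g‖₂²` always (`norm_weilConv_weilReflect_le`) and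
  `2|k(L)| ≤ ‖g‖₂²` once `t ≤ L` (`two_mul_norm_weilConv_weilReflect_le`; `k(L) = 0` for `L ≥ 2t`), so
  `|P_χ(k)| ≤ 2‖g‖₂² Σ_{n ≤ N} (Λ(n)/√n) c_n` with `c_n = 1`, or `c_n = 1/2` when `t ≤ log n`.

**THEOREM** (`UniformFloor.weilPositivityOnChar_of_budget`).  If
`log π − ψ(x) − Σ_{m<M}(1/l_m − 2t) + 2 Σ_{n ≤ N} (Λ(n)/√n) c_n ≤ log q` then `WeilPositivityOnChar χ t`.
The budget does not see the values `χ(n)`: the floor is UNIFORM over all characters of the given parity, and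
needs no `ζ` rung (contrast `GeneralTransfer.lean` / the reflection transfers, which import a `ζ` window and pay
the polar term).  Numerical floors (`t = 1`: every `χ` mod `q ≥ 900`, every odd `χ` mod `q ≥ 288`; the `ζ`
frontier `4023/5000`: `q ≥ 144`, odd `q ≥ 72`) are `UniformConductorFloorRungs.lean`.  The SHARP uniform floor
(`78` even / `30` odd at `t = 1`, cell data) is a certificate statement over the phase torus and is NOT claimed here.

## References

* A. Weil (1952), (11) pp. 261–262 and the «lemme» p. 262 [Weil1952FormulesExplicites];
  H. Yoshida (1992), §2 (2.1), §6 p. 309 (monotonicity of `Re ψ`) [Yoshida1992];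
  G. E. Andrews, R. Askey, R. Roy (1999), Thm 1.2.5 (1.2.13) (the digamma series) [AndrewsAskeyRoy1999].
-/

noncomputable section

open Complex Filter Set MeasureTheory
open scoped Real Topology ComplexConjugate ArithmeticFunction.vonMangoldt

namespace Summit.Ventures.WeilGRH

open Literature.NumberTheory.LFunctions

namespace UniformFloor

variable {q : ℕ} {g : ℝ → ℂ}

/-! ## The Lorentzian deficit of one vertical-series term -/

/-- The Lorentzian `l/(l² + (τ/2)²)` is non-negative for `l > 0`. [folklore] -/
theorem lorentz_nonneg {l : ℝ} (hl : 0 < l) (τ : ℝ) : 0 ≤ l / (l ^ 2 + (τ / 2) ^ 2) := by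
  positivity

/-- The Lorentzian is bounded by its value at `τ = 0`: `l/(l² + (τ/2)²) ≤ 1/l`. [folklore] -/
theorem lorentz_le {l : ℝ} (hl : 0 < l) (τ : ℝ) : l / (l ^ 2 + (τ / 2) ^ 2) ≤ 1 / l := by
  rw [div_le_div_iff₀ (by positivity) hl]
  nlinarith [sq_nonneg (τ / 2)]

/-- The Lorentzian is continuous. [folklore] -/
theorem continuous_lorentz {l : ℝ} (hl : 0 < l) :
    Continuous fun τ : ℝ ↦ l / (l ^ 2 + (τ / 2) ^ 2) :=
  continuous_const.div (by fun_prop) fun τ ↦ by positivity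

/-- `∫ l/(l² + (τ/2)²) dτ = 2π` for `l > 0` (substitute `τ = 2lu`, `∫ du/(1+u²) = π`). [folklore] -/
theorem integral_lorentz {l : ℝ} (hl : 0 < l) :
    ∫ τ : ℝ, l / (l ^ 2 + (τ / 2) ^ 2) = 2 * π := by
  have h : (fun τ : ℝ ↦ l / (l ^ 2 + (τ / 2) ^ 2)) =
      fun τ : ℝ ↦ l⁻¹ * (1 + (τ / (2 * l)) ^ 2)⁻¹ := by
    funext τ
    have hl0 : l ≠ 0 := hl.ne'
    field_simp
  rw [h, integral_const_mul, Measure.integral_comp_div (fun u : ℝ ↦ (1 + u ^ 2)⁻¹) (2 * l),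
    integral_univ_inv_one_add_sq, smul_eq_mul, abs_of_pos (by positivity)]
  field_simp

/-- The Lorentzian is integrable. [folklore] -/
theorem integrable_lorentz {l : ℝ} (hl : 0 < l) :
    Integrable fun τ : ℝ ↦ l / (l ^ 2 + (τ / 2) ^ 2) := by
  have h2l : (2 * l) ≠ 0 := by positivity
  have h := (integrable_inv_one_add_sq.comp_div h2l).const_mul l⁻¹
  refine h.congr (Eventually.of_forall fun τ ↦ ?_)
  have hl0 : l ≠ 0 := hl.ne'
  simp only
  field_simp

/-! ## `|ĝ(1/2 + iτ)|² ≤ 2t ‖g‖₂²` and the deficit integral -/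

/-- **`|ĝ(1/2+iτ)|² ≤ 2t‖g‖₂²`** for `tsupport g ⊆ [-t, t]` (`|ĝ| ≤ ‖g‖₁ ≤ √(2t)‖g‖₂`, Cauchy–Schwarz).
[folklore] -/
theorem norm_sq_weilMellin_le (hg : IsWeilTest g) {t : ℝ} (ht : 0 < t)
    (hsupp : tsupport g ⊆ Icc (-t) t) (τ : ℝ) :
    ‖weilMellin g (1 / 2 + τ * I)‖ ^ 2 ≤ 2 * t * weilNorm2Sq g := by
  have h1 := norm_weilMellin_half_line_le hg τ
  have h2 := weilNorm1_sq_le hg ht hsupp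
  exact (pow_le_pow_left₀ (norm_nonneg _) h1 2).trans h2

/-- **The Lorentzian deficit**: `∫ |ĝ(1/2+iτ)|² · l/(l² + τ²/4) dτ ≤ 2t‖g‖₂² · 2π`. [folklore] -/
theorem integral_norm_sq_weilMellin_mul_lorentz_le (hg : IsWeilTest g) {t : ℝ} (ht : 0 < t)
    (hsupp : tsupport g ⊆ Icc (-t) t) {l : ℝ} (hl : 0 < l) :
    ∫ τ : ℝ, ‖weilMellin g (1 / 2 + τ * I)‖ ^ 2 * (l / (l ^ 2 + (τ / 2) ^ 2)) ≤
      2 * t * weilNorm2Sq g * (2 * π) := by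
  have hI1 : Integrable fun τ : ℝ ↦ ‖weilMellin g (1 / 2 + τ * I)‖ ^ 2 * (l / (l ^ 2 + (τ / 2) ^ 2)) :=
    integrable_norm_sq_weilMellin_mul hg (continuous_lorentz hl).measurable (A := 1 / l) (B := 0)
      (by positivity) le_rfl fun τ ↦ by
        rw [abs_of_nonneg (lorentz_nonneg hl τ), zero_mul, add_zero]
        exact lorentz_le hl τ
  have hI2 : Integrable fun τ : ℝ ↦ 2 * t * weilNorm2Sq g * (l / (l ^ 2 + (τ / 2) ^ 2)) :=
    (integrable_lorentz hl).const_mul _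
  calc ∫ τ : ℝ, ‖weilMellin g (1 / 2 + τ * I)‖ ^ 2 * (l / (l ^ 2 + (τ / 2) ^ 2))
      ≤ ∫ τ : ℝ, 2 * t * weilNorm2Sq g * (l / (l ^ 2 + (τ / 2) ^ 2)) :=
        integral_mono hI1 hI2 fun τ ↦
          mul_le_mul_of_nonneg_right (norm_sq_weilMellin_le hg ht hsupp τ) (lorentz_nonneg hl τ)
    _ = 2 * t * weilNorm2Sq g * (2 * π) := by rw [integral_const_mul, integral_lorentz hl]

/-! ## The archimedean form bounded below -/

/-- **Pointwise**: `ψ(x) + Σ_{m<M} [1/(m+x) − (m+x)/((m+x)² + τ²/4)] ≤ Re ψ(x + iτ/2)` (`x > 0`): the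
first `M` terms of the vertical series `Re ψ(x+iy) − ψ(x) = Σ_m y²/(l_m(l_m²+y²))`, `l_m = m + x`, all
terms non-negative. [cite: AndrewsAskeyRoy1999, Thm 1.2.5 (1.2.13); Yoshida1992, §6 (p. 309)] -/
theorem re_digamma_ge_sum (x : ℝ) (hx : 0 < x) (M : ℕ) (τ : ℝ) :
    (digamma (x : ℂ)).re + ∑ m ∈ Finset.range M,
        (1 / ((m : ℝ) + x) - ((m : ℝ) + x) / (((m : ℝ) + x) ^ 2 + (τ / 2) ^ 2)) ≤
      (digamma ((x : ℂ) + ((τ / 2 : ℝ) : ℂ) * I)).re := by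
  have hs := DigammaVertical.hasSum_vterm hx (τ / 2)
  have hle := sum_le_hasSum (Finset.range M)
    (fun m _ ↦ DigammaVertical.vterm_nonneg (by positivity : (0 : ℝ) < (m : ℝ) + x) (τ / 2)) hs
  have heq : ∀ m ∈ Finset.range M, DigammaVertical.vterm ((m : ℝ) + x) (τ / 2) =
      1 / ((m : ℝ) + x) - ((m : ℝ) + x) / (((m : ℝ) + x) ^ 2 + (τ / 2) ^ 2) :=
    fun m _ ↦ DigammaVertical.vterm_eq (by positivity) _
  rw [← Finset.sum_congr rfl heq]
  linarith

/-- **ARCHIMEDEAN LOWER BOUND.** For a test function `g` supported in `[-t, t]`, `x > 0` and any `M`: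
`[ψ(x) + Σ_{m<M} (1/(m+x) − 2t)] · ‖g‖₂² ≤ (1/2π) ∫ |ĝ(1/2+iτ)|² Re ψ(x + iτ/2) dτ`
(keep `M` series terms; pay each Lorentzian deficit with `|ĝ|² ≤ 2t‖g‖₂²` and `∫ = 2π`; `M = 0` is the
plain monotonicity bound `Re ψ(x+iy) ≥ ψ(x)`). [folklore] -/
theorem arch_lower_bound (hg : IsWeilTest g) {t : ℝ} (ht : 0 < t) (hsupp : tsupport g ⊆ Icc (-t) t)
    {x : ℝ} (hx : 0 < x) (M : ℕ) :
    ((digamma (x : ℂ)).re + ∑ m ∈ Finset.range M, (1 / ((m : ℝ) + x) - 2 * t)) * weilNorm2Sq g ≤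
      1 / (2 * π) * ∫ τ : ℝ, ‖weilMellin g (1 / 2 + τ * I)‖ ^ 2 *
        (digamma ((x : ℂ) + ((τ / 2 : ℝ) : ℂ) * I)).re := by
  set N2 := weilNorm2Sq g with hN2
  set W : ℝ → ℝ := fun τ ↦ ‖weilMellin g (1 / 2 + τ * I)‖ ^ 2 with hW
  set L : ℕ → ℝ → ℝ := fun m τ ↦ ((m : ℝ) + x) / (((m : ℝ) + x) ^ 2 + (τ / 2) ^ 2) with hL
  set c : ℝ := (digamma (x : ℂ)).re + ∑ m ∈ Finset.range M, 1 / ((m : ℝ) + x) with hc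
  -- pointwise minorant
  have hpt : ∀ τ : ℝ, W τ * c - ∑ m ∈ Finset.range M, W τ * L m τ ≤
      W τ * (digamma ((x : ℂ) + ((τ / 2 : ℝ) : ℂ) * I)).re := by
    intro τ
    have h := re_digamma_ge_sum x hx M τ
    have hW0 : 0 ≤ W τ := by positivity
    rw [← Finset.mul_sum, ← mul_sub]
    refine mul_le_mul_of_nonneg_left ?_ hW0
    have e : c - ∑ m ∈ Finset.range M, L m τ =
        (digamma (x : ℂ)).re + ∑ m ∈ Finset.range M,
          (1 / ((m : ℝ) + x) - ((m : ℝ) + x) / (((m : ℝ) + x) ^ 2 + (τ / 2) ^ 2)) := by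
      rw [hc, Finset.sum_sub_distrib]
      ring
    rw [e]
    exact h
  -- integrability
  have hIW : Integrable W := integrable_norm_sq_weilMellin_half_line hg
  have hIψ : Integrable fun τ : ℝ ↦ W τ * (digamma ((x : ℂ) + ((τ / 2 : ℝ) : ℂ) * I)).re := by
    refine (integrable_norm_sq_weilMellin_mul_re_digamma hg hx).congr (Eventually.of_forall fun τ ↦ ?_)
    simp only [hW]
    congr 3
    push_cast
    ring
  have hIL : ∀ m : ℕ, Integrable fun τ : ℝ ↦ W τ * L m τ := fun m ↦
    integrable_norm_sq_weilMellin_mul hg (continuous_lorentz (by positivity)).measurable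
      (A := 1 / ((m : ℝ) + x)) (B := 0) (by positivity) le_rfl fun τ ↦ by
        rw [abs_of_nonneg (lorentz_nonneg (by positivity) τ), zero_mul, add_zero]
        exact lorentz_le (by positivity) τ
  have hIsum : Integrable fun τ : ℝ ↦ ∑ m ∈ Finset.range M, W τ * L m τ :=
    integrable_finsetSum _ fun m _ ↦ hIL m
  -- integrate
  have hint : ∫ τ : ℝ, (W τ * c - ∑ m ∈ Finset.range M, W τ * L m τ) ≤
      ∫ τ : ℝ, W τ * (digamma ((x : ℂ) + ((τ / 2 : ℝ) : ℂ) * I)).re :=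
    integral_mono (f := fun τ : ℝ ↦ W τ * c - ∑ m ∈ Finset.range M, W τ * L m τ)
      ((hIW.mul_const c).sub hIsum) hIψ hpt
  rw [integral_sub (hIW.mul_const c) hIsum, integral_mul_const, integral_finsetSum _ fun m _ ↦ hIL m]
    at hint
  have hP : ∫ τ : ℝ, W τ = 2 * π * N2 := integral_norm_sq_weilMellin_half_line hg
  have hLm : ∀ m ∈ Finset.range M, ∫ τ : ℝ, W τ * L m τ ≤ 2 * t * N2 * (2 * π) := fun m _ ↦
    integral_norm_sq_weilMellin_mul_lorentz_le hg ht hsupp (by positivity)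
  have hsum := Finset.sum_le_sum hLm
  rw [Finset.sum_const, Finset.card_range, nsmul_eq_mul] at hsum
  have hπ : 0 < 2 * π := by positivity
  rw [Finset.sum_sub_distrib, Finset.sum_const, Finset.card_range, nsmul_eq_mul,
    show 1 / (2 * π) * ∫ τ : ℝ, W τ * (digamma ((x : ℂ) + ((τ / 2 : ℝ) : ℂ) * I)).re =
      (∫ τ : ℝ, W τ * (digamma ((x : ℂ) + ((τ / 2 : ℝ) : ℂ) * I)).re) / (2 * π) by ring,
    le_div_iff₀ hπ]
  rw [hP] at hint
  have e2 : ((digamma (x : ℂ)).re + (∑ m ∈ Finset.range M, 1 / ((m : ℝ) + x) - (M : ℝ) * (2 * t))) *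
      N2 * (2 * π) = 2 * π * N2 * c - (M : ℝ) * (2 * t * N2 * (2 * π)) := by
    rw [hc]; ring
  rw [e2]
  linarith

/-! ## The twisted prime term bounded above -/

/-- **PRIME BOUND.** For `k = g ⋆ g̃`, `tsupport g ⊆ [-t, t]`, `e^{2t} ≤ N + 1` and weights `c_n` with
`c_n ≥ 1`, or `c_n ≥ 1/2` together with `t ≤ log n` (SLIVER case: `2|k(log n)| ≤ ‖g‖₂²`):
`|P_χ(k)| ≤ 2‖g‖₂² Σ_{n ≤ N} (Λ(n)/√n) c_n` for EVERY character `χ` (`|χ(n)| ≤ 1`).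
[cite: Weil1952FormulesExplicites, (11) pp. 261–262 (prime term); Yoshida1992, §2] -/
theorem norm_weilPrimeTermChar_le (χ : DirichletCharacter ℂ q) (hg : IsWeilTest g) {t : ℝ}
    (hsupp : tsupport g ⊆ Icc (-t) t) {N : ℕ} (hN : Real.exp (2 * t) ≤ (N : ℝ) + 1)
    (c : ℕ → ℝ) (hc : ∀ n ∈ Finset.range (N + 1), 1 ≤ c n ∨ (1 / 2 ≤ c n ∧ t ≤ Real.log n)) :
    ‖weilPrimeTermChar χ (weilConv g (weilReflect g))‖ ≤
      2 * weilNorm2Sq g * ∑ n ∈ Finset.range (N + 1), (Λ n : ℝ) / Real.sqrt n * c n := by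
  set k := weilConv g (weilReflect g) with hk
  set N2 := weilNorm2Sq g with hN2
  have hN20 : 0 ≤ N2 := integral_nonneg fun _ ↦ by positivity
  have hkc : Continuous k := (hg.weilConv hg.weilReflect).1.continuous
  have hks : tsupport k ⊆ Icc (-(2 * t)) (2 * t) := tsupport_weilConv_weilReflect_subset hg.2 hsupp
  rw [weilPrimeTermChar_eq_sum_of_tsupport_subset χ hkc hN hks, Finset.mul_sum]
  refine (norm_sum_le _ _).trans (Finset.sum_le_sum fun n hn ↦ ?_)
  have hΛ : 0 ≤ (Λ n : ℝ) / Real.sqrt n :=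
    div_nonneg ArithmeticFunction.vonMangoldt_nonneg (Real.sqrt_nonneg _)
  have hcoef : ‖((Λ n : ℝ) : ℂ) / (Real.sqrt n : ℂ)‖ = (Λ n : ℝ) / Real.sqrt n := by
    rw [← Complex.ofReal_div, Complex.norm_real, Real.norm_of_nonneg hΛ]
  have hχ : ‖χ (n : ZMod q)‖ ≤ 1 := DirichletCharacter.norm_le_one χ _
  have hneg : ‖k (-Real.log n)‖ = ‖k (Real.log n)‖ := by
    rw [hk, weilConv_weilReflect_neg, Complex.norm_conj]
  have hkey : 2 * ‖k (Real.log n)‖ ≤ 2 * c n * N2 := by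
    rcases hc n hn with h1 | ⟨h2, htn⟩
    · have hb : ‖k (Real.log n)‖ ≤ N2 := norm_weilConv_weilReflect_le hg (Real.log n)
      nlinarith
    · rcases le_or_gt (Real.log n) (2 * t) with hle | hlt
      · have hb : 2 * ‖k (Real.log n)‖ ≤ N2 := two_mul_norm_weilConv_weilReflect_le hg hsupp htn hle
        nlinarith
      · have h0 : k (Real.log n) = 0 :=
          weilConv_weilReflect_eq_zero_of_le_abs hg hsupp
            (by rw [abs_of_nonneg (Real.log_natCast_nonneg n)]; exact hlt.le)
        rw [h0, norm_zero, mul_zero]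
        positivity
  have hin : ‖χ (n : ZMod q) * k (Real.log n) + conj (χ (n : ZMod q)) * k (-Real.log n)‖ ≤
      2 * c n * N2 := by
    refine (norm_add_le _ _).trans ?_
    rw [norm_mul, norm_mul, Complex.norm_conj, hneg]
    have hk0 : 0 ≤ ‖k (Real.log n)‖ := norm_nonneg _
    nlinarith [mul_le_mul_of_nonneg_right hχ hk0]
  rw [norm_mul, hcoef]
  calc (Λ n : ℝ) / Real.sqrt n *
        ‖χ (n : ZMod q) * k (Real.log n) + conj (χ (n : ZMod q)) * k (-Real.log n)‖
      ≤ (Λ n : ℝ) / Real.sqrt n * (2 * c n * N2) := mul_le_mul_of_nonneg_left hin hΛ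
    _ = 2 * N2 * ((Λ n : ℝ) / Real.sqrt n * c n) := by ring

/-! ## The uniform floor theorem -/

/-- **`Re Q_χ` decomposed** (`q ≠ 1`, parity `κ`, `x = 1/4 + κ/2`, `k = g ⋆ g̃`):
`Q_χ(g) = −P_χ(k) + [(1/2π)∫|ĝ(1/2+iτ)|² Re ψ(x + iτ/2) dτ + ‖g‖₂²(log q − log π)]`.
[cite: Weil1952FormulesExplicites, (11) pp. 261–262 with (5), (10) pp. 254, 258] -/
theorem weilQuadraticChar_eq_neg_prime_add (hq : q ≠ 1) (χ : DirichletCharacter ℂ q) {κ : ℕ}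
    (hκ : charParity χ = κ) (hg : IsWeilTest g) :
    weilQuadraticChar χ g = -weilPrimeTermChar χ (weilConv g (weilReflect g)) +
      ((1 / (2 * π) * (∫ τ : ℝ, ‖weilMellin g (1 / 2 + τ * I)‖ ^ 2 *
          (digamma ((((1 / 4 + (κ : ℝ) / 2 : ℝ)) : ℂ) + ((τ / 2 : ℝ) : ℂ) * I)).re) +
        weilNorm2Sq g * (Real.log q - Real.log π) : ℝ) : ℂ) := by
  have hAI : weilArchIntegralChar κ (weilConv g (weilReflect g)) =
      ((∫ τ : ℝ, ‖weilMellin g (1 / 2 + τ * I)‖ ^ 2 *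
          (digamma ((((1 / 4 + (κ : ℝ) / 2 : ℝ)) : ℂ) + ((τ / 2 : ℝ) : ℂ) * I)).re : ℝ) : ℂ) := by
    rw [weilArchIntegralChar_weilConv_weilReflect hg κ]
    congr 1
    refine integral_congr_ae (Eventually.of_forall fun τ ↦ ?_)
    simp only
    congr 3
    push_cast
    ring
  have hk0 : weilConv g (weilReflect g) 0 = ((weilNorm2Sq g : ℝ) : ℂ) := by
    rw [weilConv_weilReflect_apply_zero]
    rfl
  unfold weilQuadraticChar weilFunctionalChar weilArchTermChar
  rw [if_neg hq, hκ, hAI, hk0]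
  push_cast
  ring

/-- **UNIFORM CONDUCTOR FLOOR** (no `ζ` input, no certificate).  Let `χ` be a Dirichlet character mod
`q ≠ 1` of parity `κ` (`x = 1/4 + κ/2`), `t > 0`, `e^{2t} ≤ N + 1`, `M ∈ ℕ`, `ψ₀ ≤ ψ(x)`, and weights
`c_n ≥ 1`, or `c_n ≥ 1/2` with `t ≤ log n`, for `n ≤ N`.  If
`log π − ψ₀ − Σ_{m<M}(1/(m+x) − 2t) + 2 Σ_{n≤N} (Λ(n)/√n) c_n ≤ log q`
then `WeilPositivityOnChar χ t`: indeed `Re Q_χ(g) ≥ [log q − log π + ψ₀ + Σ_{m<M}(1/(m+x) − 2t)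
− 2Σ_{n≤N}(Λ(n)/√n)c_n]·‖g‖₂² ≥ 0`.  The hypothesis does not involve the values of `χ`.
[cite: Weil1952FormulesExplicites, (11) and the «lemme» p. 262; Yoshida1992, §2 (2.1), §6] -/
theorem weilPositivityOnChar_of_budget (hq : q ≠ 1) (χ : DirichletCharacter ℂ q) {κ : ℕ}
    (hκ : charParity χ = κ) {t : ℝ} (ht : 0 < t) {N : ℕ} (hN : Real.exp (2 * t) ≤ (N : ℝ) + 1)
    (M : ℕ) {ψ₀ : ℝ} (hψ : ψ₀ ≤ (digamma (((1 / 4 + (κ : ℝ) / 2 : ℝ)) : ℂ)).re)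
    (c : ℕ → ℝ) (hc : ∀ n ∈ Finset.range (N + 1), 1 ≤ c n ∨ (1 / 2 ≤ c n ∧ t ≤ Real.log n))
    (hB : Real.log π - ψ₀ - ∑ m ∈ Finset.range M, (1 / ((m : ℝ) + (1 / 4 + (κ : ℝ) / 2)) - 2 * t) +
        2 * ∑ n ∈ Finset.range (N + 1), (Λ n : ℝ) / Real.sqrt n * c n ≤ Real.log q) :
    WeilPositivityOnChar χ t := by
  intro g hg hsupp
  set k := weilConv g (weilReflect g) with hk
  set N2 := weilNorm2Sq g with hN2
  set x : ℝ := 1 / 4 + (κ : ℝ) / 2 with hx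
  have hx0 : 0 < x := by positivity
  have hN20 : 0 ≤ N2 := integral_nonneg fun _ ↦ by positivity
  set A : ℝ := ∫ τ : ℝ, ‖weilMellin g (1 / 2 + τ * I)‖ ^ 2 *
    (digamma ((x : ℂ) + ((τ / 2 : ℝ) : ℂ) * I)).re with hA
  set S : ℝ := ∑ n ∈ Finset.range (N + 1), (Λ n : ℝ) / Real.sqrt n * c n with hS
  set G : ℝ := ∑ m ∈ Finset.range M, (1 / ((m : ℝ) + x) - 2 * t) with hG
  have hre : (weilQuadraticChar χ g).re =
      -(weilPrimeTermChar χ k).re + (1 / (2 * π) * A + N2 * (Real.log q - Real.log π)) := by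
    rw [weilQuadraticChar_eq_neg_prime_add hq χ hκ hg, Complex.add_re, Complex.neg_re, Complex.ofReal_re]
  have hP : (weilPrimeTermChar χ k).re ≤ 2 * N2 * S :=
    (Complex.re_le_norm _).trans (norm_weilPrimeTermChar_le χ hg hsupp hN c hc)
  have hArch : ((digamma (x : ℂ)).re + G) * N2 ≤ 1 / (2 * π) * A :=
    arch_lower_bound hg ht hsupp hx0 M
  have hψN : ψ₀ * N2 ≤ (digamma (x : ℂ)).re * N2 := mul_le_mul_of_nonneg_right hψ hN20
  have hBN : (Real.log π - ψ₀ - G + 2 * S) * N2 ≤ Real.log q * N2 :=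
    mul_le_mul_of_nonneg_right hB hN20
  rw [hre]
  nlinarith

end UniformFloor

end Summit.Ventures.WeilGRH

end
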